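import Literature.AlgebraicGeometry.HodgeTheory.WeilTypeCMFieldHodgeGroupUEOfLie
import Literature.AlgebraicGeometry.HodgeTheory.CMHodgeGroupKFibre
import HarnessLib

/-!
# The displayed Lie hypothesis `hSU` of the B5a-E socket for abelian varieties of Weil type with `End⁰ = E ⊋ K` a CM field,
# read on the CM type: «every `φ_ℂ`-, `φ_{E,ℂ}`-commuting `ψ_ℂ`-skew operator traceless on `W_K` lies in `Lie Hg ⊗ ℂ`» follows
# from the two-block statement «every `φ_{E,ℂ}`-commuting `ψ_ℂ`-skew operator with `tr(Y|W_{μk₁}) + tr(Y|W_{μk₂}) = 0` lies in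
# `Lie Hg ⊗ ℂ`» (TABLE X row 11; Moonen–Zarhin 1998 §4, Deligne LNM 900 §4)

Family `hodge`, layer `Literature/AlgebraicGeometry/HodgeTheory` (cell `pub-hodgeav-hg6`, req-37 (A) Q2b, TABLE X ROW 11 =
`IV(2,1).kE0`: simple abelian sixfolds with `End⁰ = E` biquadratic CM `= K·E₀`, `dim_E H¹ = 3`, CM pattern `(2,1)+(1,2)`,
`K`-Weil `(3,3)`; design note `HOME/jobs/ROW11-Esquare-eng4g8/DESIGN.md`, brick R11-6a; the unconditional row-11 reading `WeilTypeQuarticCMFieldHodgeLieSU` imports it). UNCONDITIONAL; theorems only, no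
definition, no named fact, no `sorry`. HONEST FRAMING of that cell: HC / HC_AV (stmt-1333) / HC_CM (stmt-3052) / H2 NOT proved;
this file converts one Lie-algebra statement about `Hg(A)` into another and proves neither by itself.

* **`IsWeilType.hSU_of_blockTraceLie`** — data as in the cell's B5a-E socket `WeilTypeCMFieldHodgeGroupUEOfLie` §3
  (`(A, φ)` of Weil type `(n, d)`, `φ_E ∈ End(A)` with `finrank_ℚ End⁰(A) = 2|ι|`, a CM type `μ` of `φ_E^*` with multiplicity
  `n₀`, `dim A = |ι| n₀`, the `K`-compatibility `hKE` ∕ `hKE'`: `ker(φ_{E,ℂ} − μ k) ⊆ W_K := ker(φ_ℂ − i√d)`,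
  `ker(φ_{E,ℂ} − μ̄ k) ⊆ W̄_K`), TWO places `k₁ ≠ k₂` covering `ι`, and the HS-level Lie statement `hLie`: every `φ_{E,ℂ}`-commuting
  `ψ_ℂ`-skew `Y` with `tr(Y|W_{μ k₁}) + tr(Y|W_{μ k₂}) = 0` lies in `Lie Hg(H¹A) ⊗ ℂ`. CONCLUSION: the socket's `hSU` VERBATIM
  (the `W_K`-trace is the sum of the two block traces, `CMThetaKWeil.trace_restrict_kFibre_eq_sum`). The Lie statement `hLie`
  itself is the row-11 Lie theorem (bricks R11-1…R11-5 of the design note + the eng-5 lineage's n₀ = 3 NoTwist brick); it is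
  DISPLAYED here, not proved.

## References
* [MoonenZarhin1998WeilClasses] B. Moonen, Yu. Zarhin, J. reine angew. Math. 496 (1998), §4 Remark (1).
* [Deligne1982HodgeCycles] P. Deligne, LNM 900 (1982), §4 (p. 30).
* [MumfordAV1970] D. Mumford, Abelian Varieties (1970), §19 Cor. 2 of Thm. 1 (p. 174).
-/

noncomputable section

open scoped TensorProduct
open scoped Matrix
open CategoryTheory Module

namespace Literature.AlgebraicGeometry.HodgeTheory

open Literature.AlgebraicTopology.SingularHomology
open Literature.AlgebraicGeometry.Motives (IsSmoothProjective AbelianVariety bettiCohomology HodgeTensorFacts hodgeTensorFacts_holds)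
open Literature.AlgebraicGeometry.Motives.HodgeStructure
open Literature.AlgebraicGeometry.ComplexMultiplication (bettiRep bettiRep_of)

variable {A : AbelianVariety ℂ} {φ : A ⟶ A} {n d : ℕ} {ι : Type} [Fintype ι] [DecidableEq ι]

/-- The two elements of `Fin 2`. [folklore] -/
private theorem fin2_cases₆ (r : Fin 2) : r = 0 ∨ r = 1 := by
  fin_cases r <;> simp

/-- **THE SOCKET'S `hSU` FROM THE TWO-BLOCK LIE STATEMENT** (see the module docstring): for `(A, φ)` of Weil type, `φ_E` with
a two-place CM type `μ` equal to the `K`-fibre of `W_K`, the displayed Lie hypothesis of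
`IsWeilType.mem_hodgeGroupOne_of_mem_unitaryCentralizerGroup_of_cmField_of_hodgeLieC` follows from the statement `hLie` on the
two blocks `W_{μ k₁}`, `W_{μ k₂}` — `tr(Y | W_K) = tr(Y | W_{μ k₁}) + tr(Y | W_{μ k₂})`.
[cite: MoonenZarhin1998WeilClasses, §4 Remark (1)] [cite: Deligne1982HodgeCycles, §4 (p. 30)]
[cite: MumfordAV1970, §19 Cor. 2 of Thm. 1 (p. 174)] -/
theorem IsWeilType.hSU_of_blockTraceLie [HodgeTensorFacts.{0, 0}]
    (hW : IsWeilType A φ n d) (φE : A ⟶ A) (hEcard : Module.finrank ℚ A.endAlgebra = 2 * Fintype.card ι)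
    (μ : ι → ℂ) (hinj : Function.Injective μ) (hdist : ∀ k k', μ k' ≠ starRingEnd ℂ (μ k)) {n₀ : ℕ} (hn₀ : 0 < n₀)
    (hmult : ∀ k, eigenMultiplicity A φE (μ k) + eigenMultiplicity A φE (starRingEnd ℂ (μ k)) = n₀)
    (hdim : A.dim = Fintype.card ι * n₀)
    (hKE : ∀ k, Module.End.eigenspace (((bettiCohomology.map φE.hom.hom.hom 1).hom).baseChange ℂ) (μ k) ≤
      Module.End.eigenspace (((bettiCohomology.map φ.hom.hom.hom 1).hom).baseChange ℂ) (Complex.I * (Real.sqrt d : ℂ)))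
    (hKE' : ∀ k, Module.End.eigenspace (((bettiCohomology.map φE.hom.hom.hom 1).hom).baseChange ℂ) (starRingEnd ℂ (μ k)) ≤
      Module.End.eigenspace (((bettiCohomology.map φ.hom.hom.hom 1).hom).baseChange ℂ) (-(Complex.I * (Real.sqrt d : ℂ))))
    (ψ : (BettiUniverse.hodge exists_isReal_hodgeModel_holds (AbelianVariety.isSmoothProjective_holds (A := A)) 1).Polarization)
    (k₁ k₂ : ι) (hk : k₁ ≠ k₂) (hι : ∀ k, k = k₁ ∨ k = k₂)
    (hLie : ∀ (Y : Module.End ℂ (ℂ ⊗[ℚ] bettiCohomology A.X 1))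
      (hYφE : Y * ((bettiCohomology.map φE.hom.hom.hom 1).hom).baseChange ℂ =
        ((bettiCohomology.map φE.hom.hom.hom 1).hom).baseChange ℂ * Y),
      (∀ x y, ψ.form.baseChange ℂ (Y x) y + ψ.form.baseChange ℂ x (Y y) = 0) →
      LinearMap.trace ℂ _ (Y.restrict fun x (hx : x ∈ Module.End.eigenspace
          (((bettiCohomology.map φE.hom.hom.hom 1).hom).baseChange ℂ) (μ k₁)) =>
        UnitaryTheta.apply_mem_eigenspace_of_commute hYφE hx) +
      LinearMap.trace ℂ _ (Y.restrict fun x (hx : x ∈ Module.End.eigenspace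
          (((bettiCohomology.map φE.hom.hom.hom 1).hom).baseChange ℂ) (μ k₂)) =>
        UnitaryTheta.apply_mem_eigenspace_of_commute hYφE hx) = 0 →
      Y ∈ (BettiUniverse.hodge exists_isReal_hodgeModel_holds (AbelianVariety.isSmoothProjective_holds (A := A)) 1).hodgeLieC) :
    ∀ (Y : Module.End ℂ (ℂ ⊗[ℚ] bettiCohomology A.X 1))
      (hYφ : Y * ((bettiCohomology.map φ.hom.hom.hom 1).hom).baseChange ℂ =
        ((bettiCohomology.map φ.hom.hom.hom 1).hom).baseChange ℂ * Y),
      Y * ((bettiCohomology.map φE.hom.hom.hom 1).hom).baseChange ℂ =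
        ((bettiCohomology.map φE.hom.hom.hom 1).hom).baseChange ℂ * Y →
      (∀ x y, ψ.form.baseChange ℂ (Y x) y + ψ.form.baseChange ℂ x (Y y) = 0) →
      LinearMap.trace ℂ _ (Y.restrict fun x (hx : x ∈ Module.End.eigenspace
          (((bettiCohomology.map φ.hom.hom.hom 1).hom).baseChange ℂ) (Complex.I * (Real.sqrt d : ℂ))) =>
        UnitaryTheta.apply_mem_eigenspace_of_commute hYφ hx) = 0 →
      Y ∈ (BettiUniverse.hodge exists_isReal_hodgeModel_holds (AbelianVariety.isSmoothProjective_holds (A := A)) 1).hodgeLieC := by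
  classical
  intro Y hYφ hYφE hYskew hYtr
  have hHD : exists_isReal_hodgeModel := exists_isReal_hodgeModel_holds
  have hI : hodgePQ_independent_of_hodgeModel := hodgePQ_independent_of_hodgeModel_holds
  haveI : Module.Finite ℚ (bettiCohomology A.X 1) := finite_bettiCohomology_one A
  have hX : IsSmoothProjective A.dim A.X := AbelianVariety.isSmoothProjective_holds
  have heff := BettiUniverse.hodge_isEffective hHD hX 1
  set φQ : Module.End ℚ (bettiCohomology A.X 1) := (bettiCohomology.map φ.hom.hom.hom 1).hom with hφQdef
  set φEQ : Module.End ℚ (bettiCohomology A.X 1) := (bettiCohomology.map φE.hom.hom.hom 1).hom with hφEQdef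
  set μK : ℂ := Complex.I * (Real.sqrt d : ℂ) with hμKdef
  have hμK0 : μK ≠ 0 := mul_ne_zero Complex.I_ne_zero
    (Complex.ofReal_ne_zero.2 (Real.sqrt_ne_zero'.2 (Nat.cast_pos.2 hW.d_pos)))
  have hμKne : -μK ≠ μK := fun h' => hμK0 (by
    have h2 : (2 : ℂ) * μK = 0 := by rw [two_mul]; nth_rw 1 [← h']; exact neg_add_cancel μK
    exact (mul_eq_zero.1 h2).resolve_left two_ne_zero)
  -- the CM data on `H¹(A(ℂ); ℚ)`
  have hφEE : φEQ ∈ (BettiUniverse.hodge hHD (AbelianVariety.isSmoothProjective_holds (A := A)) 1).endAlg := by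
    have h := unop_bettiRep_mem_endAlg hHD hI (AbelianVariety.endAlgebra.of A φE)
    rwa [bettiRep_of, MulOpposite.unop_op] at h
  have hVC : Module.finrank ℂ (ℂ ⊗[ℚ] bettiCohomology A.X 1) = Fintype.card (ι × Fin 2) * n₀ := by
    rw [Module.finrank_baseChange, finrank_bettiCohomology_one A, hdim, Fintype.card_prod, Fintype.card_fin]; ring
  set ev : ι × Fin 2 → ℂ := fun kt => if kt.2 = 0 then μ kt.1 else starRingEnd ℂ (μ kt.1) with hevdef
  have hev0 : ∀ k, ev (k, 0) = μ k := fun k => by simp [hevdef]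
  have hev1 : ∀ k, ev (k, 1) = starRingEnd ℂ (μ k) := fun k => by simp [hevdef]
  have hev : Function.Injective ev := by
    rintro ⟨k, t⟩ ⟨k', t'⟩ h
    rcases fin2_cases₆ t with rfl | rfl <;> rcases fin2_cases₆ t' with rfl | rfl
    · rw [hev0, hev0] at h; rw [hinj h]
    · rw [hev0, hev1] at h; exact absurd h (hdist k' k)
    · rw [hev1, hev0] at h; exact absurd h.symm (hdist k k')
    · rw [hev1, hev1] at h; rw [hinj ((starRingEnd ℂ).injective h)]
  have hgr := fun cc => CMTheta.finrank_eigenspace_eq_add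
    (BettiUniverse.hodge hHD (AbelianVariety.isSmoothProjective_holds (A := A)) 1) Nat.cast_one heff hφEE cc
  have h10 : ∀ cc, Module.finrank ℂ ↥(Module.End.eigenspace (φEQ.baseChange ℂ) cc ⊓
      (BettiUniverse.hodge hHD (AbelianVariety.isSmoothProjective_holds (A := A)) 1).piece 1 0) =
        eigenMultiplicity A φE cc := fun cc => by
    rw [hφEQdef, finrank_eigenspace_inf_piece_oneZero_eq_eigenMultiplicity hHD hI φE cc]
  have h01 : ∀ cc, Module.finrank ℂ ↥(Module.End.eigenspace (φEQ.baseChange ℂ) cc ⊓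
      (BettiUniverse.hodge hHD (AbelianVariety.isSmoothProjective_holds (A := A)) 1).piece 0 1) =
        eigenMultiplicity A φE (starRingEnd ℂ cc) := fun cc => by
    rw [hφEQdef, finrank_eigenspace_inf_piece_zeroOne_eq_eigenMultiplicity_conj hHD hI φE cc]
  have hfin : ∀ kt, Module.finrank ℂ ↥(Module.End.eigenspace (φEQ.baseChange ℂ) (ev kt)) = n₀ := by
    rintro ⟨k, t⟩
    rw [hgr, h10, h01]
    rcases fin2_cases₆ t with rfl | rfl
    · rw [hev0]; exact hmult k
    · rw [hev1, starRingEnd_self_apply, add_comm]; exact hmult k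
  have hWne : ∀ kt, Module.End.eigenspace (φEQ.baseChange ℂ) (ev kt) ≠ ⊥ := by
    intro kt hkt
    have h := hfin kt
    rw [hkt, finrank_bot] at h
    omega
  have hcard : Fintype.card (ι × Fin 2) = 2 * Fintype.card ι := by
    rw [Fintype.card_prod, Fintype.card_fin, mul_comm]
  set eι : ι × Fin 2 ≃ Fin (2 * Fintype.card ι) := Fintype.equivFinOfCardEq hcard with heιdef
  have hEφ := exists_eq_sum_smul_pow_bettiMapHom_fin hHD hI φE hEcard (ev ∘ eι.symm) (hev.comp eι.symm.injective)
    fun j => hWne (eι.symm j)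
  have hrank : ∀ k, Module.finrank ℂ ↥(Module.End.eigenspace (φEQ.baseChange ℂ) (μ k) ⊓
      (BettiUniverse.hodge hHD (AbelianVariety.isSmoothProjective_holds (A := A)) 1).piece 1 0) +
      Module.finrank ℂ ↥(Module.End.eigenspace (φEQ.baseChange ℂ) (μ k) ⊓
      (BettiUniverse.hodge hHD (AbelianVariety.isSmoothProjective_holds (A := A)) 1).piece 0 1) = n₀ := fun k => by
    rw [h10, h01]; exact hmult k
  have htop : (⨆ kt : ι × Fin 2, Module.End.eigenspace (φEQ.baseChange ℂ) (ev kt)) = ⊤ := by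
    have hind : iSupIndep fun kt => Module.End.eigenspace (φEQ.baseChange ℂ) (ev kt) :=
      (Module.End.eigenspaces_iSupIndep (φEQ.baseChange ℂ)).comp hev
    apply Submodule.eq_top_of_finrank_eq
    have h := Motives.finrank_biSup_eq_sum_of_iSupIndep hind Finset.univ
    have hs : (⨆ kt ∈ (Finset.univ : Finset (ι × Fin 2)), Module.End.eigenspace (φEQ.baseChange ℂ) (ev kt)) =
        ⨆ kt, Module.End.eigenspace (φEQ.baseChange ℂ) (ev kt) := by simp
    rw [hs] at h
    rw [h, hVC, Finset.sum_congr rfl fun kt _ => hfin kt, Finset.sum_const, Finset.card_univ, smul_eq_mul]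
  -- the `W_K`-trace is the sum of the two block traces
  have hsum := CMThetaKWeil.trace_restrict_kFibre_eq_sum
    (BettiUniverse.hodge hHD (AbelianVariety.isSmoothProjective_holds (A := A)) 1) Nat.cast_one heff ψ hφEE hEφ μ hinj hdist
    hrank htop (y := φQ) (ν := μK) (ν' := -μK) hμKne hKE hKE' hYφE hYφ
  have huniv : (Finset.univ : Finset ι) = {k₁, k₂} := by
    ext k
    simp only [Finset.mem_univ, Finset.mem_insert, Finset.mem_singleton, true_iff]
    exact hι k
  rw [huniv, Finset.sum_insert (by rw [Finset.mem_singleton]; exact hk), Finset.sum_singleton] at hsum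
  exact hLie Y hYφE hYskew (by rw [← hsum]; exact hYtr)

end Literature.AlgebraicGeometry.HodgeTheory

end
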